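import Literature.NumberTheory.GaloisRepresentations.IdeleTruncatedSLocalInjectivityHom
import HarnessLib

/-!
# The degree-`0` input [P0-epi] of the permutation dévissage DISCHARGED (every family of local equivariant
# homomorphisms `φ_w^* X → K̄_wˣ`, `w ∣ S ∪ ∞`, comes from ONE `G_S`-morphism `X ⟶ Ī_S` — -w6's existence half of
# Harari Prop. 17.26 / Milne I Lemma 4.13), and the localisation injectivity with THREE displayed inputs

Topic `NumberTheory/GaloisRepresentations`; namespace `Literature.NumberTheory.GaloisRepresentations.IdeleReadout`.
Theorems only; NO named fact, no `sorry`, no instance, no notation; number fields in `Type`.  Sequel of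
`IdeleTruncatedSLocalInjectivityHom` (bsd-eis -w4 g20, E4d) and -w6 g11's `IdeleBarKSInflationAssembly`
(**`exists_hom_readoutInvariant_sharp_eq`**: (R3)_S, the idèle assembly for `G_S` and `I_S`).

* §1 **`idLocMap_zero_surjective`** — [P0-epi]: for `X ∈ C_{G_S}` of finite type the degree-`0` localisation map
  `Ext⁰(X, Ī_S) → ∏_{w ∣ S ∪ ∞} Ext⁰(φ_w^* X, K̄_wˣ)` is onto: read each component as an invariant of `Hom(X|_w, K̄_wˣ)`
  (`invariantOfEquivariant`), extend by `0` at the finite places off `S`, assemble with -w6's theorem, and compare the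
  readouts of `f♯` with the components of `[f]` (both are `π_w (f x)` by `rfl`).
* §2 **`idLocMap_injective_two_of_inputs''`** — injectivity of `Ext²_{G_S}(A, Ī_S) → ∏_{w∣S∪∞} Ext²_{Γ_{K_w}}(φ_w^* A, K̄_wˣ)`
  for finite `A` from the THREE cohomological inputs [P1-mono], [P1-epi-local], [P2-mono] (bsd-eis -w3 g18's E3 shapes);
  both degree-`0` inputs are now proved.

HONEST FRAMING: bookkeeping around one existence theorem; the three remaining inputs are quoted, not proved; no case
of Poitou–Tate duality and nothing about BSD is proved here.  Lane «PT-Ш-S-TC» of crux `stmt-BirchSwinnertonDyer-19032`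
(cell bsd-eis, seat bsd-line-x1-p1-w4 gen 20), file E4e.  AI formalisation, established only by the kernel check.

## References
* D. Harari, *Galois Cohomology and Class Field Theory*, Universitext (2020), Prop. 17.26 (proof: existence of the
  idèle-valued homomorphism), §17.5 Prop. 17.25. [Harari2020]
* J. S. Milne, *Arithmetic Duality Theorems*, 2nd ed. (2006), I Lemma 4.13, I Thm. 4.10 (a) (proof, p. 58). [MilneADT2006]
-/

noncomputable section

open NumberField IsDedekindDomain Field CategoryTheory CategoryTheory.Limits CategoryTheory.Abelian
open Literature.Algebra.Homology Literature.Algebra.Homology.DiscreteRep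
open scoped Classical

namespace Literature.NumberTheory.GaloisRepresentations

namespace IdeleReadout

open IdeleClassBar HomDual DGMBridge DiscreteGaloisModule

variable (K : Type) [Field K] [NumberField K] (S : Finset (HeightOneSpectrum (𝓞 K)))

/-! ## §1 [P0-epi]: the degree-`0` localisation map is onto on finite-type objects -/

section Surj

-- door-c4's convention: prefer the representation's own `ℤ`-module structure on `X.obj.V`.
attribute [local instance 10000] Rep.hV2

variable {K S}
variable (X : DiscreteRepCat ℤ (GaloisGroupUnramifiedOutside K (↑S : Set (HeightOneSpectrum (𝓞 K)))))

/-- A morphism `g : φ_w^* X ⟶ K̄_wˣ` of `C_{Γ_{K_w}}` as an invariant of `Hom_ℤ(X|_w, K̄_wˣ)` (door-c6's currency).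
[cite: MilneADT2006, I Lemma 4.13 (proof)] -/
def invariantOfLocHom [Module.Finite ℤ (LCarrier ((inflKS K S).obj X))] (w : Place K)
    (g : (resDHom ℤ (decompMapPlaceS K S w) (continuous_decompMapPlaceS K S w)).obj X ⟶ unitsD (Place.Completion w)) :
    (homGaloisModule ((toDGM ((inflKS K S).obj X)).restrictField (Place.Completion w))
      (units (Place.Completion w))).toTopRep.ρ.invariants :=
  invariantOfEquivariant _ _
    ((AddMonoidHom.mk' (fun x : LCarrier ((inflKS K S).obj X) => g.hom.hom (LCarrier.val ((inflKS K S).obj X) x))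
      (fun a b => by rw [map_add]; exact g.hom.hom.toLinearMap.map_add _ _)).toIntLinearMap)
    fun σ x => Rep.hom_comm_apply g.hom σ (LCarrier.val ((inflKS K S).obj X) x)

/-- **[P0-epi]**: for `X ∈ C_{G_S}` finitely generated over `ℤ`, every family of morphisms
`g_w : φ_w^* X ⟶ K̄_wˣ` (`w ∣ S ∪ ∞`) is the localisation of ONE `f : X ⟶ Ī_S` — the degree-`0` localisation map
`idLocMap K S X 0` is onto (-w6's `exists_hom_readoutInvariant_sharp_eq`, with zero data at the finite places off `S`).
[cite: Harari2020, Prop. 17.26 (proof)][cite: MilneADT2006, I Lemma 4.13 (proof)] -/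
theorem idLocMap_zero_surjective (hX : letI : Module ℤ X.obj.V := X.obj.hV2; Module.Finite ℤ X.obj.V) :
    Function.Surjective (idLocMap K S X 0) := by
  haveI : Module.Finite ℤ (LCarrier ((inflKS K S).obj X)) := moduleFinite_lcarrier ((inflKS K S).obj X) hX
  obtain ⟨E, -, hXE⟩ := exists_galLayer_insideKS_forall_ρ_eq X hX
  intro y
  -- the components as morphisms
  have hy : ∀ w : OverS K S, ∃ g : (locFun K S w).obj X ⟶ unitsD (Place.Completion w.1), Ext.mk₀ g = y w :=
    fun w => (Ext.mk₀_bijective _ _).2 (y w)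
  choose g hg using hy
  -- the readout data at every place (zero off `S`)
  let h : ∀ v : Place K, (homGaloisModule ((toDGM ((inflKS K S).obj X)).restrictField (Place.Completion v))
      (units (Place.Completion v))).toTopRep.ρ.invariants :=
    fun v => if hv : IsOverS K S v then invariantOfLocHom X v (g ⟨v, hv⟩) else 0
  have hzero : ∀ v : HeightOneSpectrum (𝓞 K), v ∉ S → h (Sum.inr v) = 0 := fun v hv => by
    change (if hv' : IsOverS K S (Sum.inr v) then _ else _) = _
    rw [dif_neg (show ¬ IsOverS K S (Sum.inr v) from hv)]
  obtain ⟨f, hf⟩ := exists_hom_readoutInvariant_sharp_eq X E hXE h hzero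
  refine ⟨Ext.mk₀ f, funext fun w => ?_⟩
  rw [ExtLocalization.locMap_mk₀, ← hg w]
  congr 1
  apply ObjectProperty.hom_ext
  apply Rep.hom_ext
  refine DFunLike.ext _ _ fun x => ?_
  have hsel : h w.1 = invariantOfLocHom X w.1 (g w) := by
    change (if hv' : IsOverS K S w.1 then _ else _) = _
    rw [dif_pos w.2]
  have hlin := congrArg
    (fun i : (homGaloisModule ((toDGM ((inflKS K S).obj X)).restrictField (Place.Completion w.1))
      (units (Place.Completion w.1))).toTopRep.ρ.invariants =>
      DiscreteRep.HomCarrier.toLinearMap i.1 (LCarrier.of ((inflKS K S).obj X) x))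
    ((hf w.1).trans hsel)
  change (ideleProjection K w.1).toAddMonoidHom ((truncIdeleBar K S).subtype (f.hom.hom x)) = (g w).hom.hom x
  exact hlin

end Surj

/-! ## §2 The localisation injectivity from the three cohomological inputs -/

section FiniteType

attribute [local instance 10000] Rep.hV2

variable {K S}

omit [NumberField K] in
/-- `Coind_U^{G_S}(ℤ)` is finitely generated over `ℤ` (functions on the finite set `U\G_S`; as E4a's
`moduleFinite_coindD_triv` for `ℤ^m`). [cite: MilneADT2006, I Lemma 1.9 (proof)] -/
theorem moduleFinite_coindD_triv_int
    (U : Subgroup (GaloisGroupUnramifiedOutside K (↑S : Set (HeightOneSpectrum (𝓞 K)))))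
    (hU : IsOpen (U : Set (GaloisGroupUnramifiedOutside K (↑S : Set (HeightOneSpectrum (𝓞 K)))))) [U.FiniteIndex] :
    Module.Finite ℤ ((coindD ℤ U hU).obj (triv (k := ℤ) (Γ := ↥U) ℤ)).obj.V := by
  haveI : Finite (Quotient (QuotientGroup.rightRel U)) :=
    Finite.of_equiv _ (QuotientGroup.quotientRightRelEquivQuotientLeftRel U).symm
  let e : ((coindD ℤ U hU).obj (triv (k := ℤ) (Γ := ↥U) ℤ)).obj.V →ₗ[ℤ]
      (Quotient (QuotientGroup.rightRel U) → ℤ) :=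
    { toFun := fun f q => Quotient.liftOn q (fun x => f.1 x) fun x y hxy => by
        have hxy' : y * x⁻¹ ∈ U := QuotientGroup.rightRel_apply.mp hxy
        have : y = ((⟨y * x⁻¹, hxy'⟩ : U) : GaloisGroupUnramifiedOutside K ↑S) * x := by simp
        change f.1 x = f.1 y
        rw [this]
        exact (((Representation.mem_coindV _ _ _).1 f.2) ⟨_, hxy'⟩ x).symm
      map_add' := fun f f' => funext fun q => Quotient.inductionOn q fun x => rfl
      map_smul' := fun c f => funext fun q => Quotient.inductionOn q fun x => rfl }
  have he : Function.Injective e := fun f f' h => Subtype.ext (funext fun x =>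
    congrFun h (Quotient.mk _ x))
  exact Module.Finite.of_injective e he

end FiniteType

/-- **Injectivity of `Ext²_{G_S}(A, Ī_S) → ∏_{w ∣ S ∪ ∞} Ext²_{Γ_{K_w}}(φ_w^* A, K̄_wˣ)` for finite `A`** from
[P1-mono] `H¹(U, Ī_S) = 0`, [P1-epi-local] `H¹(φ_w⁻¹U, K̄_wˣ) = 0` and [P2-mono] (injectivity of the conjugated local
pull-backs on `H²(U, Ī_S)`) — the degree-`0` inputs being `idLocMap_zero_surjective` and `idLocMap_zero_injective`.
[cite: MilneADT2006, I Lemma 4.13, I Thm. 4.10 (a) (proof, p. 58)][cite: Harari2020, §17.5 Prop. 17.25, Prop. 17.26] -/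
theorem idLocMap_injective_two_of_inputs''
    (A : DiscreteRepCat ℤ (GaloisGroupUnramifiedOutside K (↑S : Set (HeightOneSpectrum (𝓞 K))))) [Finite A.obj.V]
    (U : Subgroup (GaloisGroupUnramifiedOutside K (↑S : Set (HeightOneSpectrum (𝓞 K))))) [hUn : U.Normal]
    (hU : IsOpen (U : Set (GaloisGroupUnramifiedOutside K (↑S : Set (HeightOneSpectrum (𝓞 K)))))) [U.FiniteIndex]
    (hUA : ∀ u : GaloisGroupUnramifiedOutside K (↑S : Set (HeightOneSpectrum (𝓞 K))), u ∈ U →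
      ∀ a : A.obj.V, A.obj.ρ u a = a)
    (P1mono : ∀ y : Ext (triv (k := ℤ) (Γ := ↥U) ℤ) ((resD ℤ U).obj (truncIdeleBarD K S)) 1, y = 0)
    (P1epi : ∀ (w : OverS K S) (z : Ext (triv (k := ℤ) (Γ := ↥(U.comap (decompMapPlaceS K S w.1))) ℤ)
      ((resD ℤ (U.comap (decompMapPlaceS K S w.1))).obj (unitsD (Place.Completion w.1))) 1), z = 0)
    (P2mono : ∀ y : Ext (triv (k := ℤ) (Γ := ↥U) ℤ) ((resD ℤ U).obj (truncIdeleBarD K S)) 2,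
      (∀ (w : OverS K S) (t : DoubleCosets (decompMapPlaceS K S w.1) U),
        (y.mapExactFunctor (resDHom ℤ (conjHom (decompMapPlaceS K S w.1) U (dcRep (decompMapPlaceS K S w.1) U t))
          (continuous_conjHom (decompMapPlaceS K S w.1) (continuous_decompMapPlaceS K S w.1) U
            (dcRep (decompMapPlaceS K S w.1) U t)))).comp
          (Ext.mk₀ (conjCoeff (decompMapPlaceS K S w.1) (continuous_decompMapPlaceS K S w.1) U
            (truncIdeleBarD K S) (unitsD (Place.Completion w.1)) (locQ K S w) (dcRep (decompMapPlaceS K S w.1) U t)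
            (k := ℤ))) (add_zero 2) = 0) → y = 0) :
    Function.Injective (idLocMap K S A 2) :=
  idLocMap_injective_two_of_inputs' K S A U hU hUA P1mono P1epi P2mono
    (idLocMap_zero_surjective ((coindD ℤ U hU).obj (triv (k := ℤ) (Γ := ↥U) ℤ)) (moduleFinite_coindD_triv_int U hU))

end IdeleReadout

end Literature.NumberTheory.GaloisRepresentations

end
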